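import Summits.Ventures.CertifiedManyBodySolver.Downfold.EmeryFermiScaleHarmonicLever
import Summits.Ventures.CertifiedManyBodySolver.Downfold.EmeryFaceOrdinateLever
import HarnessLib

/-!
# THE ANTINODAL SCALE LEVER BY STRUCTURE: in the shape-favourable regime `β(ε₁) ≤ 0` the lever is the FIXED-HARMONIC LEVER plus the monotone motion of the face point — a second proof,
# independent of the 2016-term certificate of `EmeryFermiScaleFaceCLever`

Venture CertifiedManyBodySolver, cell `pub/hubbard-downfold` (stage S1; INFLATION-RULES-3to1-B §B.75 (e)(f), §B.74 (b″)), seat hubbard-downfold-mod-4 (technique B, g30); namespace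
`Summit.Ventures.CertifiedManyBodySolver.Downfold.Emery`. Sequel of `EmeryFermiScaleHarmonicLever` (`scaleT_lt_of_tpHarm_le_of_beta_nonpos`: window-free certificates over `{Q, P}`) and
`EmeryFaceOrdinateLever` (`yFace_mono`: the face point moves toward the zone corner as the energy rises). Everything PROVED (0 sorry). WHAT THIS IS NOT: a statement about any material;
`U = 0` one-body kinematics; NOT a replacement of `scaleT_face_strictAnti` (which needs no sign of `β`) — a structural cross-check: two disjoint certificate families (808 + 790 + 83 terms
here vs 2016 there) prove the same inequality where both apply (β(ε₁) ≤ 0: 49 of the 54 typed lever rows).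

* **`scaleT_face_strictAnti_of_beta_nonpos`**: `Δ > 0`, `0 ≤ t_pp′ ≤ t_pp ≤ |t_pd|`, `0 < ε₁ < ε₂`, `t_pp′ε₂ < t_pd²`, `t_ppΔ ≤ 4t_pd²`, `faceG(ε₁) ≥ 0`, `cA(ε₂) ≤ (8fsD + 16fsN)(ε₂)`,
  `β(ε₁) ≤ 0` ⇒ `t_face(ε₂) < t_face(ε₁)`. Proof: both face points lie on their contours (`charCubic_yFace`), the face harmonic is `s = 1 − yFace` and `yFace(ε₁) ≤ yFace(ε₂)`
  (`yFace_mono`), so `s(ε₂) ≤ s(ε₁)`; `scaleT_lt_of_tpHarm_le_of_beta_nonpos` closes.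

Sources: three-band model [HybertsenSchluterChristensen1989, Eq. (1)]; [AndersenEtAl1995, §6]; [folklore].
-/

noncomputable section

namespace Summit.Ventures.CertifiedManyBodySolver.Downfold.Emery

open Real Set

/-- **THE ANTINODAL SCALE LEVER IN THE SHAPE-FAVOURABLE REGIME, BY STRUCTURE** (`β(ε₁) ≤ 0`; regime `t_ppΔ ≤ 4t_pd²`, `t_pp ≤ |t_pd|`; face window): `t_face(ε₂) < t_face(ε₁)` —
from the fixed-harmonic lever and `yFace_mono`, without the general certificate. [folklore] -/
theorem scaleT_face_strictAnti_of_beta_nonpos {Δ tpd tpp c ε₁ ε₂ : ℝ} (hΔ : 0 < Δ) (hc : 0 ≤ c) (hct : c ≤ tpp) (hp : tpp ^ 2 ≤ tpd ^ 2) (h1 : 0 < ε₁) (h12 : ε₁ < ε₂)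
    (hm : c * ε₂ < tpd ^ 2) (hq : tpp * Δ ≤ 4 * tpd ^ 2) (hlo : 0 ≤ faceG Δ tpd c ε₁) (hhi : cA Δ ε₂ ≤ 8 * fsD Δ tpd c ε₂ + 16 * fsN tpd tpp c ε₂)
    (hβ : scaleBeta Δ tpd tpp c ε₁ ≤ 0) :
    scaleT Δ tpd tpp c 1 (yFace Δ tpd tpp c ε₂) ε₂ < scaleT Δ tpd tpp c 1 (yFace Δ tpd tpp c ε₁) ε₁ := by
  have h2 : 0 < ε₂ := h1.trans h12
  have hE1 : 0 < Δ + ε₁ := by linarith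
  have hE2 : 0 < Δ + ε₂ := by linarith
  have hm1 : c * ε₁ < tpd ^ 2 := lt_of_le_of_lt (mul_le_mul_of_nonneg_left h12.le hc) hm
  have hD1 : 0 < fsD Δ tpd c ε₁ := fsD_pos hE1 hm1
  have hD2 : 0 < fsD Δ tpd c ε₂ := fsD_pos hE2 hm
  have hN1 : 0 ≤ fsN tpd tpp c ε₁ := fsN_nonneg (tpd := tpd) hc hct h1.le
  have hN2 : 0 ≤ fsN tpd tpp c ε₂ := fsN_nonneg (tpd := tpd) hc hct h2.le
  have hF1 : 0 < 4 * fsD Δ tpd c ε₁ + 16 * fsN tpd tpp c ε₁ := by positivity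
  have hF2 : 0 < 4 * fsD Δ tpd c ε₂ + 16 * fsN tpd tpp c ε₂ := by positivity
  have hT1 : 0 < fsT Δ tpd tpp c ε₁ := by unfold fsT; positivity
  have hT2 : 0 < fsT Δ tpd tpp c ε₂ := by unfold fsT; positivity
  have hlo2 : 0 ≤ faceG Δ tpd c ε₂ := hlo.trans (faceG_mono hΔ.le hc h1.le h12.le)
  -- the two face points lie on their contours and in the zone
  have hP1 := charCubic_yFace hF1.ne'
  have hP2 := charCubic_yFace hF2.ne'
  have hy2lo : 0 ≤ yFace Δ tpd tpp c ε₂ := (yFace_nonneg_iff hF2 hE2).2 hlo2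
  have hy2hi : yFace Δ tpd tpp c ε₂ ≤ 1 := (yFace_le_one_iff hF2).2 hhi
  have hW1 := dcharCubic_face_pos hE1 hc hct h1 hm1 hlo
  have hW2 := dcharCubic_face_pos hE2 hc hct h2 hm hlo2
  -- the face harmonic 1 − yFace does not increase
  have hy := yFace_mono hΔ.le hc hct h1 h12.le hm hlo hhi
  have hs : tpHarm 1 (yFace Δ tpd tpp c ε₂) ≤ tpHarm 1 (yFace Δ tpd tpp c ε₁) := by rw [tpHarm_face, tpHarm_face]; linarith
  exact scaleT_lt_of_tpHarm_le_of_beta_nonpos hΔ hc hct hp h1 h12 hm hq ⟨zero_le_one, le_rfl⟩ ⟨hy2lo, hy2hi⟩ hP1 hP2 hT1 hT2 hW1 hW2 hβ hs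

end Summit.Ventures.CertifiedManyBodySolver.Downfold.Emery
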